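/-
Copyright (c) 2026. All rights reserved.
Released under Apache 2.0 license as described in the file LICENSE.
-/
import Literature.AlgebraicGeometry.Pohlmann1968.DegenerateCMTypesAbelianCMFieldOneOddPrime
import HarnessLib

/-!
# ABELIAN CM fields whose Galois group has exponent `4p^k`, ANY `k`: the RANK FORMULA
# `Rank(Φ) + b + 2e₄ + Σ_{j<k} ((p−1)p^j · e_{2p^{j+1}} + 2(p−1)p^j · e_{4p^{j+1}}) = [K:ℚ]/2 + 1`; `ℚ(ζ₁₀₉)`

Topic `Literature/AlgebraicGeometry/Pohlmann1968` (namespace `Literature.AlgebraicGeometry.Pohlmann1968.ExponentFourTimesPrimePowerRank`); cell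
`pub-hodgecm2` (COR-CM), KEPT Literature lane `lit-deligne-3` gen 64, file F64h — the general-`k` RANK FORMULA (item 1 of the lane's own g64 outlook, done in
the same generation): the neighbours `ExponentTwicePrime{,Square}`, `ExponentFourTimesPrime{,Square}` write it out for `k ≤ 2`, `…OneOddPrime` (F64g) gives the
`j`-free nondegeneracy criterion; here the defect is summed over `j < k` with Euler's weights.  KERNEL ONLY: theorems; no `def`, no named fact, no instance, no
notation (D-0014 ∕ D-0026 net debt `0`).  HC_CM is NOT proved here or anywhere in the lane.

## Mathematics

T. Kubota [Kubota1965], §4 LEMMA 2 by kernels (tree `AbelianKernels.typeRank_add_sum_totient_eq`: `rank(S) + Σ_H φ([G:H]) = |G|/2 + 1` over the admissible kernels).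
If `g^{4p^k} = 1` on `G` the admissible kernels have index `2, 4, 2p^{j+1}, 4p^{j+1}` with `j < k` (`index_eq_of_isCyclic_quotient_lt`), decided by even split ∕
halving ∕ equidistribution ∕ equidistribution (tree + F64b-1 ∕ F64d), and `φ = 1, 2, (p−1)p^j, 2(p−1)p^j` (`totient_eq_indicator_sum`, private).  Hence

  `Rank(Φ) + b(Φ) + 2·e₄(Φ) + Σ_{j<k} ((p−1)p^j · e_{2p^{j+1}}(Φ) + 2(p−1)p^j · e_{4p^{j+1}}(Φ)) = [K:ℚ]/2 + 1`

with `b` = #imaginary quadratic subfields over which `Φ` is balanced, `e₄` = #CM subfields `F` with `Gal(F/ℚ) ≅ ℤ/4` every embedding of which has `[K:F]/2`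
extensions in `Φ`, and `e_n` = #CM subfields of degree `n` with CYCLIC Galois group over which `Φ` is LEVEL of exponent `p`.

* §0 private arithmetic: `index_facts` (the admissible indices are pairwise distinct), `totient_eq_indicator_sum`.
* §1 GROUP LEVEL: `index_eq_of_isCyclic_quotient_lt` (with the bound `j < k`), **`typeRank_add_card_kernels_eq`** (the summed formula; `Finset.sum_comm` over
  kernels and exponents).
* §2 FIELD LEVEL: `cmTypeRank_add_card_kernels_eq` (on `Gal`), **`cmTypeRank_add_ncard_subfields_eq`** (THE INTRINSIC SUMMED RANK FORMULA).
* §3 CYCLOTOMIC: `cmTypeRank_add_ncard_subfields_eq_of_isCyclotomicExtension`; **`cmTypeRank_add_ncard_subfields_oneHundredNine`** (`ℚ(ζ₁₀₉)`, `ℤ/108`, `k = 3`: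
  `Rank + b + 2e₄ + Σ_{j<3} (2·3^j e_{2·3^{j+1}} + 4·3^j e_{4·3^{j+1}}) = 55`, i.e. `Rank + 2e₄ + 4e₁₂ + 12e₃₆ + 36e₁₀₈ = 55` as `b = e₆ = e₁₈ = e₅₄ = 0` there).

PRESEARCH (lane rule): as for the neighbours — not found as printed (corpus hybrid + vector; galaxy «degenerate CM type | nondegenerate CM type», all stars); Kubota's
Lemma 2 regrouped by kernels with the four vanishing criteria; recorded as the lane's own elementary theorem with the printed ingredients cited.

HONEST REGISTER.  Unconditional and elementary given the tree's theorems; nothing is claimed for DEGENERATE types; no census numerics (the `k ≤ 2` censuses are in the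
neighbours' headers).  HC_CM is NOT proved and not used.

## References

* [Kubota1965] T. Kubota, *On the field extension by complex multiplication*, Trans. AMS 118 (1965), §4 Lemma 2.
* [Dodson1984] B. Dodson, *The structure of Galois groups of CM-fields*, Trans. AMS 283 (1984), §3.1.1 Theorem.
* [Dodson1987] B. Dodson, *On the Mumford–Tate group of an abelian variety with complex multiplication*, J. Algebra 111 (1987), Prop. 4.4.
* [Hazama2003CyclicCM] F. Hazama, J. Math. Sci. Univ. Tokyo 10 (2003), Prop. 4.3, Lemma 4.6.1.
* [Gordon1999HodgeAVSurvey] B. B. Gordon, *A survey of the Hodge conjecture for abelian varieties*, 5.13 (ii), 9.4.1, 9.4.3.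
* [Yanai2015IndexDegeneracy] H. Yanai, *On the index of degeneracy of a CM-type*, Thm. 4.1 (proof, p. 818).

## Provenance

Cell `pub-hodgecm2` (COR-CM), KEPT Literature lane `lit-deligne-3` gen 64 (claim ABELIAN-ONE-ODD-PRIME-RANK; count-neutral, own lane), file F64h (generated from the lane's
template, desk `gen_f64h.py`); neighbours cited by name, nothing restated: `DegenerateCMTypesAbelianKernels{,IndexFour,IndexFourMulPrimePower}`,
`…CyclicSubfields` ∕ `…CyclicQuarticSubfields` (index `2` ∕ `4` dictionaries), `…ExponentFourTimesPrime` (`card_index_isCyclic_eq_ncard_level`,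
`cm_abelian_pow_eq_one_of_isCyclotomicExtension`), `…OneOddPrime` (`index_eq_of_isCyclic_quotient`, `units_pow_oneHundredEight_oneHundredNine`).  Theorems only;
net Literature debt 0.
-/

noncomputable section

open scoped BigOperators NumberField IsMulCommutative Classical
open NumberField IntermediateField

namespace Literature.AlgebraicGeometry.Pohlmann1968

namespace ExponentFourTimesPrimePowerRank

open Literature.NumberTheory.ComplexMultiplication
open Literature.NumberTheory.ComplexMultiplication.CMNumbers
open Literature.AlgebraicGeometry.Motives (CMType)
open Literature.AlgebraicGeometry.Pohlmann1968.CyclicTwoOddPrimes (isCMTypeWith_galType cmTypeRank_eq_typeRank_galType)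
open Literature.AlgebraicGeometry.Pohlmann1968.AbelianKernels
open Literature.AlgebraicGeometry.Pohlmann1968.ExponentFourTimesPrime (card_index_isCyclic_eq_ncard_level
  cm_abelian_pow_eq_one_of_isCyclotomicExtension)

/-! ## §0 Arithmetic: the admissible indices and Euler's `φ` as an indicator sum -/

section Arith

variable {p : ℕ}

/-- The admissible indices `2p^{a+1}`, `4p^{a+1}` (`p` odd) are pairwise distinct and distinct from `2`, `4`. [folklore] -/
private theorem index_facts (hp : p.Prime) (hp2 : p ≠ 2) (a b : ℕ) :
    2 * p ^ (a + 1) ≠ 2 ∧ 2 * p ^ (a + 1) ≠ 4 ∧ 4 * p ^ (a + 1) ≠ 2 ∧ 4 * p ^ (a + 1) ≠ 4 ∧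
      2 * p ^ (a + 1) ≠ 4 * p ^ (b + 1) ∧ (2 * p ^ (a + 1) = 2 * p ^ (b + 1) → a = b) ∧
      (4 * p ^ (a + 1) = 4 * p ^ (b + 1) → a = b) := by
  obtain ⟨m, hm⟩ : Odd (p ^ (a + 1)) := (hp.odd_of_ne_two hp2).pow
  have h3 : 3 ≤ p ^ (a + 1) := by
    have hp3 : 3 ≤ p := by
      have := hp.two_le
      rcases Nat.lt_or_ge 2 p with h' | h'
      · omega
      · exfalso; exact hp2 (le_antisymm h' this)
    calc 3 ≤ p := hp3
      _ = p ^ 1 := (pow_one p).symm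
      _ ≤ p ^ (a + 1) := Nat.pow_le_pow_right hp.pos (Nat.le_add_left 1 a)
  have hinj : p ^ (a + 1) = p ^ (b + 1) → a = b := fun h =>
    Nat.succ_injective (Nat.pow_right_injective hp.two_le h)
  refine ⟨by omega, by omega, by omega, by omega, by omega, fun h => hinj (by omega), fun h => hinj (by omega)⟩

/-- **Euler's `φ` on an admissible index as an indicator sum**: for `n ∈ {2, 4} ∪ {2p^{j+1}, 4p^{j+1} : j < k}`,
`φ(n) = [n=2] + 2[n=4] + Σ_{j<k} ((p−1)p^j [n = 2p^{j+1}] + 2(p−1)p^j [n = 4p^{j+1}])`. [folklore] -/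
private theorem totient_eq_indicator_sum (hp : p.Prime) (hp2 : p ≠ 2) {k n : ℕ}
    (hn : n = 2 ∨ n = 4 ∨ ∃ j < k, n = 2 * p ^ (j + 1) ∨ n = 4 * p ^ (j + 1)) :
    n.totient = (if n = 2 then 1 else 0) + 2 * (if n = 4 then 1 else 0) +
      ∑ j ∈ Finset.range k, ((p - 1) * p ^ j * (if n = 2 * p ^ (j + 1) then 1 else 0) +
        2 * ((p - 1) * p ^ j) * (if n = 4 * p ^ (j + 1) then 1 else 0)) := by
  have ht4 : Nat.totient 4 = 2 := by decide
  have h2p : Nat.Coprime 2 p := (Nat.coprime_primes Nat.prime_two hp).2 hp2.symm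
  have h4p : Nat.Coprime 4 p := by rw [show (4 : ℕ) = 2 ^ 2 by norm_num]; exact h2p.pow_left 2
  have D1 : ∀ j : ℕ, (2 : ℕ) ≠ 2 * p ^ (j + 1) := fun j => Ne.symm (index_facts hp hp2 j j).1
  have D2 : ∀ j : ℕ, (2 : ℕ) ≠ 4 * p ^ (j + 1) := fun j => Ne.symm (index_facts hp hp2 j j).2.2.1
  have D3 : ∀ j : ℕ, (4 : ℕ) ≠ 2 * p ^ (j + 1) := fun j => Ne.symm (index_facts hp hp2 j j).2.1
  have D4 : ∀ j : ℕ, (4 : ℕ) ≠ 4 * p ^ (j + 1) := fun j => Ne.symm (index_facts hp hp2 j j).2.2.2.1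
  rcases hn with rfl | rfl | ⟨j₀, hj₀, rfl | rfl⟩
  · simp [D1, D2, Nat.totient_two]
  · simp [D3, D4, ht4]
  · obtain ⟨d1, d2, -⟩ := index_facts hp hp2 j₀ j₀
    rw [if_neg d1, if_neg d2, Finset.sum_eq_single j₀, if_pos rfl, if_neg (index_facts hp hp2 j₀ j₀).2.2.2.2.1,
      Nat.totient_mul (h2p.pow_right _), Nat.totient_two, Nat.totient_prime_pow_succ hp]
    · simp [mul_comm]
    · intro j _ hne
      rw [if_neg (fun h => hne ((index_facts hp hp2 j₀ j).2.2.2.2.2.1 h).symm),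
        if_neg (index_facts hp hp2 j₀ j).2.2.2.2.1]
      simp
    · intro h; exact absurd (Finset.mem_range.2 hj₀) h
  · obtain ⟨-, -, d3, d4, -⟩ := index_facts hp hp2 j₀ j₀
    rw [if_neg d3, if_neg d4, Finset.sum_eq_single j₀, if_neg (fun h => (index_facts hp hp2 j₀ j₀).2.2.2.2.1 h.symm), if_pos rfl,
      Nat.totient_mul (h4p.pow_right _), ht4, Nat.totient_prime_pow_succ hp]
    · simp [mul_comm]
    · intro j _ hne
      rw [if_neg (fun h => (index_facts hp hp2 j j₀).2.2.2.2.1 h.symm),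
        if_neg (fun h => hne ((index_facts hp hp2 j₀ j).2.2.2.2.2.2 h).symm)]
      simp
    · intro h; exact absurd (Finset.mem_range.2 hj₀) h

end Arith

/-! ## §1 Group level: the rank formula in exponent `4p^k`, any `k` -/

section Group

variable {G : Type*} [CommGroup G] {p k : ℕ}

/-- The admissible kernels in exponent `4p^k` have index `2`, `4`, `2p^{j+1}` or `4p^{j+1}` with `j < k` (the bound recorded).
[cite: Kubota1965, §4 Lemma 2] -/
theorem index_eq_of_isCyclic_quotient_lt [hp : Fact p.Prime] (hp2 : p ≠ 2) (hexp : ∀ g : G, g ^ (4 * p ^ k) = 1)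
    {H : Subgroup G} {ρ : G} (hρH : ρ ∉ H) (hρ2 : ρ * ρ = 1) (hcyc : IsCyclic (G ⧸ H)) :
    H.index = 2 ∨ H.index = 4 ∨ ∃ j < k, H.index = 2 * p ^ (j + 1) ∨ H.index = 4 * p ^ (j + 1) := by
  haveI := hcyc
  have hdvd : H.index ∣ 4 * p ^ k := by
    rw [Subgroup.index_eq_card, ← IsCyclic.exponent_eq_card]
    exact Monoid.exponent_dvd_of_forall_pow_eq_one fun q => QuotientGroup.induction_on q fun g => by
      rw [← QuotientGroup.mk_pow, hexp, QuotientGroup.mk_one]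
  have hc : ∀ j : ℕ, Nat.Coprime (p ^ (j + 1)) 4 := fun j => by
    rw [show (4 : ℕ) = 2 ^ 2 by norm_num]
    exact ((Nat.coprime_primes hp.out Nat.prime_two).2 hp2).pow (j + 1) 2
  have hle : ∀ j : ℕ, p ^ (j + 1) ∣ H.index → j < k := fun j hj =>
    (Nat.pow_dvd_pow_iff_le_right hp.out.one_lt).1 ((hc j).dvd_of_dvd_mul_left (hj.trans hdvd))
  rcases ExponentFourTimesPrimePower.index_eq_of_isCyclic_quotient hp2 hexp hρH hρ2 hcyc with hi | hi | ⟨j, hi | hi⟩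
  · exact Or.inl hi
  · exact Or.inr (Or.inl hi)
  · exact Or.inr (Or.inr ⟨j, hle j (hi ▸ Dvd.intro_left 2 rfl), Or.inl hi⟩)
  · exact Or.inr (Or.inr ⟨j, hle j (hi ▸ Dvd.intro_left 4 rfl), Or.inr hi⟩)

variable [Fintype G] [DecidableEq G]

/-- **THE RANK OF A CM TYPE IN EXPONENT `4p^k`, ANY `k` (group level).**  Let `G` be a finite commutative group with `g^{4p^k} = 1` for all `g`
(`p` an odd prime), `ρ ∈ G`, `T` a CM type (`T ⊔ ρT = G`).  Then

  `rank(T) + #B₂ + 2·#B₄ + Σ_{j<k} ((p−1)p^j · #B_{2p^{j+1}} + 2(p−1)p^j · #B_{4p^{j+1}}) = |G|/2 + 1`,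

`B₂` = index-`2` subgroups `H ∌ ρ` splitting `T` evenly; `B₄` = index-`4` subgroups `H ∌ ρ` with cyclic quotient met in half of every coset; `B_{2p^{j+1}}`,
`B_{4p^{j+1}}` = subgroups `H ∌ ρ` of that index WITH CYCLIC QUOTIENT at which `T` is EQUIDISTRIBUTED along the subgroup of order `p` of `G/H`
(`#(T ∩ gxH) = #(T ∩ gH)` for all `g`, all `x` with `x^p ∈ H`).  Kubota's defect `Σ_H φ([G:H])` over the admissible kernels (tree
`AbelianKernels.typeRank_add_sum_totient_eq`), the kernels having index `2, 4, 2p^{j+1}, 4p^{j+1}` (`j < k`) and being decided by the tree's ∕ the lane's four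
criteria; `φ = 1, 2, (p−1)p^j, 2(p−1)p^j`.  The cases `k ≤ 2` written out are the neighbours `ExponentTwicePrime{,Square}`, `ExponentFourTimesPrime{,Square}`;
the `j`-free NONDEGENERACY criterion is `ExponentFourTimesPrimePower.typeRank_eq_iff`. [cite: Kubota1965, §4 Lemma 2]
[cite: Hazama2003CyclicCM, Prop. 4.3 and Lemma 4.6.1] [cite: Dodson1984, §3.1.1 Theorem] [cite: Dodson1987, Prop. 4.4] [cite: Gordon1999HodgeAVSurvey, 9.4.3] -/
theorem typeRank_add_card_kernels_eq [hp : Fact p.Prime] (hp2 : p ≠ 2) {ρ : G} {T : Finset G}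
    (h : IsCMTypeWith ρ (T : Set G)) (hexp : ∀ g : G, g ^ (4 * p ^ k) = 1) :
    typeRank G (T : Set G) + ((Finset.univ : Finset (Subgroup G)).filter fun H : Subgroup G => ρ ∉ H ∧ H.index = 2 ∧
        (T.filter fun s => s ∈ H).card = (T.filter fun s => s ∉ H).card).card + 2 * ((Finset.univ : Finset (Subgroup G)).filter fun H : Subgroup G => ρ ∉ H ∧ H.index = 4 ∧ IsCyclic (G ⧸ H) ∧
        ∀ g : G, 2 * ((T.filter fun s => g⁻¹ * s ∈ H).card) = Nat.card H).card +
      ∑ j ∈ Finset.range k, ((p - 1) * p ^ j * ((Finset.univ : Finset (Subgroup G)).filter fun H : Subgroup G => ρ ∉ H ∧ H.index = 2 * p ^ (j + 1) ∧ IsCyclic (G ⧸ H) ∧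
        ∀ x : G, x ^ p ∈ H → ∀ g : G,
          (T.filter fun s => (g * x)⁻¹ * s ∈ H).card = (T.filter fun s => g⁻¹ * s ∈ H).card).card +
        2 * ((p - 1) * p ^ j) * ((Finset.univ : Finset (Subgroup G)).filter fun H : Subgroup G => ρ ∉ H ∧ H.index = 4 * p ^ (j + 1) ∧ IsCyclic (G ⧸ H) ∧
        ∀ x : G, x ^ p ∈ H → ∀ g : G,
          (T.filter fun s => (g * x)⁻¹ * s ∈ H).card = (T.filter fun s => g⁻¹ * s ∈ H).card).card) =
      Fintype.card G / 2 + 1 := by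
  have hρ2 : ρ * ρ = 1 := by simpa [smul_eq_mul] using h.invol (1 : G)
  have key := CyclicCMType.AbelianKernels.typeRank_add_sum_totient_eq h
  set A := (Finset.univ : Finset (Subgroup G)).filter (fun H => ρ ∉ H ∧ IsCyclic (G ⧸ H) ∧
    ∀ χ : AddChar (Additive G) ℂ, (∀ g : G, χ (Additive.ofMul g) = 1 ↔ g ∈ H) →
      ∑ s ∈ T, χ (Additive.ofMul s) = 0) with hA
  -- index `2`
  have hA₂ : A.filter (fun H => H.index = 2) = ((Finset.univ : Finset (Subgroup G)).filter fun H : Subgroup G => ρ ∉ H ∧ H.index = 2 ∧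
        (T.filter fun s => s ∈ H).card = (T.filter fun s => s ∉ H).card) := by
    rw [hA, Finset.filter_filter]
    refine Finset.filter_congr fun H _ => ?_
    constructor
    · rintro ⟨⟨hρH, -, hchar⟩, hidx⟩
      exact ⟨hρH, hidx,
        (CyclicCMType.AbelianKernels.forall_sum_char_eq_zero_iff_of_index_two hρ2 hρH hidx T).1 hchar⟩
    · rintro ⟨hρH, hidx, hsplit⟩
      haveI : Fact (Nat.Prime 2) := ⟨Nat.prime_two⟩
      exact ⟨⟨hρH, isCyclic_of_prime_card (p := 2) (by rw [← Subgroup.index_eq_card, hidx]),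
        (CyclicCMType.AbelianKernels.forall_sum_char_eq_zero_iff_of_index_two hρ2 hρH hidx T).2 hsplit⟩, hidx⟩
  -- index `4`
  have hA₄ : A.filter (fun H => H.index = 4) = ((Finset.univ : Finset (Subgroup G)).filter fun H : Subgroup G => ρ ∉ H ∧ H.index = 4 ∧ IsCyclic (G ⧸ H) ∧
        ∀ g : G, 2 * ((T.filter fun s => g⁻¹ * s ∈ H).card) = Nat.card H) := by
    rw [hA, Finset.filter_filter]
    refine Finset.filter_congr fun H _ => ?_
    constructor
    · rintro ⟨⟨hρH, hcyc, hchar⟩, hidx⟩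
      exact ⟨hρH, hidx, hcyc,
        (CyclicCMType.AbelianKernels.forall_sum_char_eq_zero_iff_of_index_four h hρH hidx hcyc).1 hchar⟩
    · rintro ⟨hρH, hidx, hcyc, hhalf⟩
      exact ⟨⟨hρH, hcyc,
        (CyclicCMType.AbelianKernels.forall_sum_char_eq_zero_iff_of_index_four h hρH hidx hcyc).2 hhalf⟩, hidx⟩
  -- index `2p^{j+1}`
  have hA' : ∀ j : ℕ, A.filter (fun H => H.index = 2 * p ^ (j + 1)) = ((Finset.univ : Finset (Subgroup G)).filter fun H : Subgroup G => ρ ∉ H ∧ H.index = 2 * p ^ (j + 1) ∧ IsCyclic (G ⧸ H) ∧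
        ∀ x : G, x ^ p ∈ H → ∀ g : G,
          (T.filter fun s => (g * x)⁻¹ * s ∈ H).card = (T.filter fun s => g⁻¹ * s ∈ H).card) := by
    intro j
    rw [hA, Finset.filter_filter]
    refine Finset.filter_congr fun H _ => ?_
    constructor
    · rintro ⟨⟨hρH, hcyc, hchar⟩, hidx⟩
      exact ⟨hρH, hidx, hcyc, (CyclicCMType.AbelianKernels.forall_sum_char_eq_zero_iff_equidistributed_of_index
        hp2 h hρH hcyc hidx).1 hchar⟩
    · rintro ⟨hρH, hidx, hcyc, hE⟩
      exact ⟨⟨hρH, hcyc, (CyclicCMType.AbelianKernels.forall_sum_char_eq_zero_iff_equidistributed_of_index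
        hp2 h hρH hcyc hidx).2 hE⟩, hidx⟩
  -- index `4p^{j+1}`
  have hA'' : ∀ j : ℕ, A.filter (fun H => H.index = 4 * p ^ (j + 1)) = ((Finset.univ : Finset (Subgroup G)).filter fun H : Subgroup G => ρ ∉ H ∧ H.index = 4 * p ^ (j + 1) ∧ IsCyclic (G ⧸ H) ∧
        ∀ x : G, x ^ p ∈ H → ∀ g : G,
          (T.filter fun s => (g * x)⁻¹ * s ∈ H).card = (T.filter fun s => g⁻¹ * s ∈ H).card) := by
    intro j
    rw [hA, Finset.filter_filter]
    refine Finset.filter_congr fun H _ => ?_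
    constructor
    · rintro ⟨⟨hρH, hcyc, hchar⟩, hidx⟩
      exact ⟨hρH, hidx, hcyc, (CyclicCMType.AbelianKernels.forall_sum_char_eq_zero_iff_equidistributed_of_index_four_mul_primePow
        hp2 h hρH hcyc hidx).1 hchar⟩
    · rintro ⟨hρH, hidx, hcyc, hE⟩
      exact ⟨⟨hρH, hcyc, (CyclicCMType.AbelianKernels.forall_sum_char_eq_zero_iff_equidistributed_of_index_four_mul_primePow
        hp2 h hρH hcyc hidx).2 hE⟩, hidx⟩
  -- Euler's `φ` on the admissible kernels, pointwise
  have hpt : ∀ H ∈ A, H.index.totient = (if H.index = 2 then 1 else 0) + 2 * (if H.index = 4 then 1 else 0) +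
      ∑ j ∈ Finset.range k, ((p - 1) * p ^ j * (if H.index = 2 * p ^ (j + 1) then 1 else 0) +
        2 * ((p - 1) * p ^ j) * (if H.index = 4 * p ^ (j + 1) then 1 else 0)) := by
    intro H hH
    rw [hA, Finset.mem_filter] at hH
    obtain ⟨-, hρH, hcyc, -⟩ := hH
    exact totient_eq_indicator_sum hp.out hp2 (index_eq_of_isCyclic_quotient_lt hp2 hexp hρH hρ2 hcyc)
  have hsum : ∑ H ∈ A, H.index.totient = ((Finset.univ : Finset (Subgroup G)).filter fun H : Subgroup G => ρ ∉ H ∧ H.index = 2 ∧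
        (T.filter fun s => s ∈ H).card = (T.filter fun s => s ∉ H).card).card + 2 * ((Finset.univ : Finset (Subgroup G)).filter fun H : Subgroup G => ρ ∉ H ∧ H.index = 4 ∧ IsCyclic (G ⧸ H) ∧
        ∀ g : G, 2 * ((T.filter fun s => g⁻¹ * s ∈ H).card) = Nat.card H).card +
      ∑ j ∈ Finset.range k, ((p - 1) * p ^ j * ((Finset.univ : Finset (Subgroup G)).filter fun H : Subgroup G => ρ ∉ H ∧ H.index = 2 * p ^ (j + 1) ∧ IsCyclic (G ⧸ H) ∧
        ∀ x : G, x ^ p ∈ H → ∀ g : G,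
          (T.filter fun s => (g * x)⁻¹ * s ∈ H).card = (T.filter fun s => g⁻¹ * s ∈ H).card).card + 2 * ((p - 1) * p ^ j) * ((Finset.univ : Finset (Subgroup G)).filter fun H : Subgroup G => ρ ∉ H ∧ H.index = 4 * p ^ (j + 1) ∧ IsCyclic (G ⧸ H) ∧
        ∀ x : G, x ^ p ∈ H → ∀ g : G,
          (T.filter fun s => (g * x)⁻¹ * s ∈ H).card = (T.filter fun s => g⁻¹ * s ∈ H).card).card) := by
    rw [Finset.sum_congr rfl hpt, Finset.sum_add_distrib, Finset.sum_add_distrib, ← Finset.mul_sum, ← Finset.card_filter,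
      ← Finset.card_filter, hA₂, hA₄, Finset.sum_comm]
    congr 1
    refine Finset.sum_congr rfl fun j _ => ?_
    rw [Finset.sum_add_distrib, ← Finset.mul_sum, ← Finset.mul_sum, ← Finset.card_filter, ← Finset.card_filter, hA' j, hA'' j]
  have e : typeRank G (T : Set G) + ((Finset.univ : Finset (Subgroup G)).filter fun H : Subgroup G => ρ ∉ H ∧ H.index = 2 ∧
        (T.filter fun s => s ∈ H).card = (T.filter fun s => s ∉ H).card).card + 2 * ((Finset.univ : Finset (Subgroup G)).filter fun H : Subgroup G => ρ ∉ H ∧ H.index = 4 ∧ IsCyclic (G ⧸ H) ∧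
        ∀ g : G, 2 * ((T.filter fun s => g⁻¹ * s ∈ H).card) = Nat.card H).card +
      ∑ j ∈ Finset.range k, ((p - 1) * p ^ j * ((Finset.univ : Finset (Subgroup G)).filter fun H : Subgroup G => ρ ∉ H ∧ H.index = 2 * p ^ (j + 1) ∧ IsCyclic (G ⧸ H) ∧
        ∀ x : G, x ^ p ∈ H → ∀ g : G,
          (T.filter fun s => (g * x)⁻¹ * s ∈ H).card = (T.filter fun s => g⁻¹ * s ∈ H).card).card + 2 * ((p - 1) * p ^ j) * ((Finset.univ : Finset (Subgroup G)).filter fun H : Subgroup G => ρ ∉ H ∧ H.index = 4 * p ^ (j + 1) ∧ IsCyclic (G ⧸ H) ∧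
        ∀ x : G, x ^ p ∈ H → ∀ g : G,
          (T.filter fun s => (g * x)⁻¹ * s ∈ H).card = (T.filter fun s => g⁻¹ * s ∈ H).card).card) =
      typeRank G (T : Set G) + ∑ H ∈ A, H.index.totient := by
    rw [hsum]; ring
  rw [e]
  exact key

end Group

/-! ## §2 Abelian CM fields with Galois group of exponent `4p^k`: the rank formula on the lattice of subfields -/

section Field

variable {K : Type} [Field K] [NumberField K] [IsCMField K] [IsAbelianGalois ℚ K] {p k : ℕ}

/-- **The defect on `Gal(K/ℚ)`, exponent `4p^k`** (the families of `typeRank_add_card_kernels_eq` on the subgroups of `Gal(K/ℚ)`).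
[cite: Kubota1965, §4 Lemma 2] [cite: Hazama2003CyclicCM, Prop. 4.3] [cite: Dodson1984, §3.1.1 Theorem] [cite: Dodson1987, Prop. 4.4]
[cite: Gordon1999HodgeAVSurvey, 9.4.3] -/
theorem cmTypeRank_add_card_kernels_eq [Fact p.Prime] (hp2 : p ≠ 2) (φ₀ : K →+* ℂ)
    (hexp : ∀ g : K ≃ₐ[ℚ] K, g ^ (4 * p ^ k) = 1) (Φ : CMType K) :
    cmTypeRank Φ + ((Finset.univ : Finset (Subgroup (K ≃ₐ[ℚ] K))).filter fun H : Subgroup (K ≃ₐ[ℚ] K) =>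
        (conjGal : K ≃ₐ[ℚ] K) ∉ H ∧ H.index = 2 ∧
        ((Finset.univ.filter fun g : K ≃ₐ[ℚ] K => embOf φ₀ g ∈ Φ.1).filter fun s => s ∈ H).card =
          ((Finset.univ.filter fun g : K ≃ₐ[ℚ] K => embOf φ₀ g ∈ Φ.1).filter fun s => s ∉ H).card).card + 2 * ((Finset.univ : Finset (Subgroup (K ≃ₐ[ℚ] K))).filter fun H : Subgroup (K ≃ₐ[ℚ] K) =>
        (conjGal : K ≃ₐ[ℚ] K) ∉ H ∧ H.index = 4 ∧ IsCyclic ((K ≃ₐ[ℚ] K) ⧸ H) ∧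
        ∀ g : K ≃ₐ[ℚ] K, 2 * (((Finset.univ.filter fun g : K ≃ₐ[ℚ] K => embOf φ₀ g ∈ Φ.1).filter
          fun s => g⁻¹ * s ∈ H).card) = Nat.card H).card +
      ∑ j ∈ Finset.range k, ((p - 1) * p ^ j * ((Finset.univ : Finset (Subgroup (K ≃ₐ[ℚ] K))).filter fun H : Subgroup (K ≃ₐ[ℚ] K) =>
        (conjGal : K ≃ₐ[ℚ] K) ∉ H ∧ H.index = 2 * p ^ (j + 1) ∧ IsCyclic ((K ≃ₐ[ℚ] K) ⧸ H) ∧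
        ∀ x : K ≃ₐ[ℚ] K, x ^ p ∈ H → ∀ g : K ≃ₐ[ℚ] K,
          ((Finset.univ.filter fun g : K ≃ₐ[ℚ] K => embOf φ₀ g ∈ Φ.1).filter fun s => (g * x)⁻¹ * s ∈ H).card =
          ((Finset.univ.filter fun g : K ≃ₐ[ℚ] K => embOf φ₀ g ∈ Φ.1).filter fun s => g⁻¹ * s ∈ H).card).card +
        2 * ((p - 1) * p ^ j) * ((Finset.univ : Finset (Subgroup (K ≃ₐ[ℚ] K))).filter fun H : Subgroup (K ≃ₐ[ℚ] K) =>
        (conjGal : K ≃ₐ[ℚ] K) ∉ H ∧ H.index = 4 * p ^ (j + 1) ∧ IsCyclic ((K ≃ₐ[ℚ] K) ⧸ H) ∧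
        ∀ x : K ≃ₐ[ℚ] K, x ^ p ∈ H → ∀ g : K ≃ₐ[ℚ] K,
          ((Finset.univ.filter fun g : K ≃ₐ[ℚ] K => embOf φ₀ g ∈ Φ.1).filter fun s => (g * x)⁻¹ * s ∈ H).card =
          ((Finset.univ.filter fun g : K ≃ₐ[ℚ] K => embOf φ₀ g ∈ Φ.1).filter fun s => g⁻¹ * s ∈ H).card).card) =
      Module.finrank ℚ K / 2 + 1 := by
  rw [cmTypeRank_eq_typeRank_galType Φ φ₀, ← card_gal_eq_finrank φ₀]
  exact typeRank_add_card_kernels_eq hp2 (isCMTypeWith_galType (AbelianCMFieldExistence.apply_conjGal_eq φ₀) Φ) hexp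

/-- **THE RANK OF A CM TYPE OF AN ABELIAN CM FIELD OF EXPONENT `4p^k`, ANY `k`, ON THE LATTICE OF SUBFIELDS.**  Let `K` be a CM field, abelian over
`ℚ`, with `g^{4p^k} = 1` on `Gal(K/ℚ)` (`p` an odd prime), `Φ` ANY CM type.  Then

  `Rank(Φ) + b + 2·e₄ + Σ_{j<k} ((p−1)p^j · e_{2p^{j+1}} + 2(p−1)p^j · e_{4p^{j+1}}) = [K:ℚ]/2 + 1`,

`b` = #imaginary quadratic subfields over which `Φ` is balanced (Weil type); `e₄` = #CM subfields `F` with `Gal(F/ℚ) ≅ ℤ/4` every embedding of which has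
`[K:F]/2` extensions in `Φ`; `e_n` (`n = 2p^{j+1}, 4p^{j+1}`) = #CM subfields of degree `n` with CYCLIC Galois group over which `Φ` is LEVEL of exponent `p` (for
every `σ ∈ Gal(F/ℚ)` with `σ^p = 1` and every `τ : F → ℂ`, `#{φ ∈ Φ : φ|_F = τ ∘ σ} = #{φ ∈ Φ : φ|_F = τ}`).  Kubota's defect of `Φ` is the displayed sum.
[cite: Kubota1965, §4 Lemma 2] [cite: Hazama2003CyclicCM, Prop. 4.3 and Lemma 4.6.1] [cite: Dodson1984, §3.1.1 Theorem] [cite: Dodson1987, Prop. 4.4]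
[cite: Gordon1999HodgeAVSurvey, 5.13 (ii), 9.4.1 and 9.4.3] [cite: Yanai2015IndexDegeneracy, Thm. 4.1 (proof, p. 818)] -/
theorem cmTypeRank_add_ncard_subfields_eq [Fact p.Prime] (hp2 : p ≠ 2)
    (hexp : ∀ g : K ≃ₐ[ℚ] K, g ^ (4 * p ^ k) = 1) (Φ : CMType K) :
    cmTypeRank Φ + {F : IntermediateField ℚ K | Module.finrank ℚ F = 2 ∧ ¬ IsTotallyReal F ∧
        ∀ τ : F →+* ℂ, {φ : K →+* ℂ | φ.comp (algebraMap F K) = τ ∧ φ ∈ Φ.1}.ncard =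
          {φ : K →+* ℂ | φ.comp (algebraMap F K) = τ ∧ φ ∉ Φ.1}.ncard}.ncard +
      2 * {F : IntermediateField ℚ K | Module.finrank ℚ F = 4 ∧ ¬ IsTotallyReal F ∧ IsCyclic (F ≃ₐ[ℚ] F) ∧
        ∀ τ : F →+* ℂ, 2 * {φ : K →+* ℂ | φ.comp (algebraMap F K) = τ ∧ φ ∈ Φ.1}.ncard = Module.finrank F K}.ncard +
      ∑ j ∈ Finset.range k, ((p - 1) * p ^ j * {F : IntermediateField ℚ K | Module.finrank ℚ F = 2 * p ^ (j + 1) ∧ ¬ IsTotallyReal F ∧ IsCyclic (F ≃ₐ[ℚ] F) ∧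
        ∀ σ : F ≃ₐ[ℚ] F, σ ^ p = 1 → ∀ τ : F →+* ℂ,
          {φ : K →+* ℂ | φ.comp (algebraMap F K) = τ.comp σ.toRingEquiv.toRingHom ∧ φ ∈ Φ.1}.ncard =
            {φ : K →+* ℂ | φ.comp (algebraMap F K) = τ ∧ φ ∈ Φ.1}.ncard}.ncard +
        2 * ((p - 1) * p ^ j) * {F : IntermediateField ℚ K | Module.finrank ℚ F = 4 * p ^ (j + 1) ∧ ¬ IsTotallyReal F ∧ IsCyclic (F ≃ₐ[ℚ] F) ∧
        ∀ σ : F ≃ₐ[ℚ] F, σ ^ p = 1 → ∀ τ : F →+* ℂ,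
          {φ : K →+* ℂ | φ.comp (algebraMap F K) = τ.comp σ.toRingEquiv.toRingHom ∧ φ ∈ Φ.1}.ncard =
            {φ : K →+* ℂ | φ.comp (algebraMap F K) = τ ∧ φ ∈ Φ.1}.ncard}.ncard) = Module.finrank ℚ K / 2 + 1 := by
  obtain ⟨φ₀⟩ := (inferInstance : Nonempty (K →+* ℂ))
  rw [← card_indexTwo_eq_ncard_weilQuadratic φ₀ Φ, ← card_indexFour_eq_ncard_weilQuartic φ₀ Φ]
  simp_rw [← card_index_isCyclic_eq_ncard_level φ₀ Φ]
  exact cmTypeRank_add_card_kernels_eq hp2 φ₀ hexp Φ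

end Field

/-! ## §3 Cyclotomic fields: `ℚ(ζ_q)` with `u^{4p^k} = 1` on `(ℤ/q)ˣ` -/

section Cyclotomic

variable {q p k : ℕ} {L : Type} [Field L] [NumberField L]

/-- **The rank formula for `ℚ(ζ_q)`, `(ℤ/q)ˣ` of exponent dividing `4p^k`** (any `k`). [cite: Kubota1965, §4 Lemma 2] [cite: Hazama2003CyclicCM, Prop. 4.3]
[cite: Dodson1984, §3.1.1 Theorem] [cite: Dodson1987, Prop. 4.4] [cite: Gordon1999HodgeAVSurvey, 9.4.3] -/
theorem cmTypeRank_add_ncard_subfields_eq_of_isCyclotomicExtension [NeZero q] [IsCyclotomicExtension {q} ℚ L]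
    (h2q : 2 < q) [Fact p.Prime] (hp2 : p ≠ 2) (hq : ∀ u : (ZMod q)ˣ, u ^ (4 * p ^ k) = 1) (Φ : CMType L) :
    cmTypeRank Φ + {F : IntermediateField ℚ L | Module.finrank ℚ F = 2 ∧ ¬ IsTotallyReal F ∧
        ∀ τ : F →+* ℂ, {φ : L →+* ℂ | φ.comp (algebraMap F L) = τ ∧ φ ∈ Φ.1}.ncard =
          {φ : L →+* ℂ | φ.comp (algebraMap F L) = τ ∧ φ ∉ Φ.1}.ncard}.ncard +
      2 * {F : IntermediateField ℚ L | Module.finrank ℚ F = 4 ∧ ¬ IsTotallyReal F ∧ IsCyclic (F ≃ₐ[ℚ] F) ∧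
        ∀ τ : F →+* ℂ, 2 * {φ : L →+* ℂ | φ.comp (algebraMap F L) = τ ∧ φ ∈ Φ.1}.ncard = Module.finrank F L}.ncard +
      ∑ j ∈ Finset.range k, ((p - 1) * p ^ j * {F : IntermediateField ℚ L | Module.finrank ℚ F = 2 * p ^ (j + 1) ∧ ¬ IsTotallyReal F ∧ IsCyclic (F ≃ₐ[ℚ] F) ∧
        ∀ σ : F ≃ₐ[ℚ] F, σ ^ p = 1 → ∀ τ : F →+* ℂ,
          {φ : L →+* ℂ | φ.comp (algebraMap F L) = τ.comp σ.toRingEquiv.toRingHom ∧ φ ∈ Φ.1}.ncard =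
            {φ : L →+* ℂ | φ.comp (algebraMap F L) = τ ∧ φ ∈ Φ.1}.ncard}.ncard +
        2 * ((p - 1) * p ^ j) * {F : IntermediateField ℚ L | Module.finrank ℚ F = 4 * p ^ (j + 1) ∧ ¬ IsTotallyReal F ∧ IsCyclic (F ≃ₐ[ℚ] F) ∧
        ∀ σ : F ≃ₐ[ℚ] F, σ ^ p = 1 → ∀ τ : F →+* ℂ,
          {φ : L →+* ℂ | φ.comp (algebraMap F L) = τ.comp σ.toRingEquiv.toRingHom ∧ φ ∈ Φ.1}.ncard =
            {φ : L →+* ℂ | φ.comp (algebraMap F L) = τ ∧ φ ∈ Φ.1}.ncard}.ncard) = Nat.totient q / 2 + 1 := by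
  obtain ⟨hcm, hab, hexp, hL⟩ := cm_abelian_pow_eq_one_of_isCyclotomicExtension h2q hq L
  haveI := hcm; haveI := hab
  rw [← hL]
  exact cmTypeRank_add_ncard_subfields_eq hp2 hexp Φ

/-- **`ℚ(ζ₁₀₉)` (degree `108`, `Gal ≅ ℤ/108 = ℤ/4 × ℤ/27`, `k = 3`): the rank formula in summed form** — `Rank(Φ) + b + 2e₄ + Σ_{j<3} (2·3^j e_{2·3^{j+1}} +
4·3^j e_{4·3^{j+1}}) = 55`; on this cyclic field the subfields of degree `2, 6, 18, 54` are real, so the formula reads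
`Rank(Φ) + 2e₄ + 4e₁₂ + 12e₃₆ + 36e₁₀₈ = 55` (`e₁₀₈ = 1` iff `Φ` is stable under the subgroup of order `3`).
[cite: Kubota1965, §4 Lemma 2] [cite: Dodson1987, Prop. 4.4] [cite: Gordon1999HodgeAVSurvey, 9.4.3] -/
theorem cmTypeRank_add_ncard_subfields_oneHundredNine [IsCyclotomicExtension {109} ℚ L] (Φ : CMType L) :
    cmTypeRank Φ + {F : IntermediateField ℚ L | Module.finrank ℚ F = 2 ∧ ¬ IsTotallyReal F ∧
        ∀ τ : F →+* ℂ, {φ : L →+* ℂ | φ.comp (algebraMap F L) = τ ∧ φ ∈ Φ.1}.ncard =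
          {φ : L →+* ℂ | φ.comp (algebraMap F L) = τ ∧ φ ∉ Φ.1}.ncard}.ncard +
      2 * {F : IntermediateField ℚ L | Module.finrank ℚ F = 4 ∧ ¬ IsTotallyReal F ∧ IsCyclic (F ≃ₐ[ℚ] F) ∧
        ∀ τ : F →+* ℂ, 2 * {φ : L →+* ℂ | φ.comp (algebraMap F L) = τ ∧ φ ∈ Φ.1}.ncard = Module.finrank F L}.ncard +
      ∑ j ∈ Finset.range 3, ((3 - 1) * 3 ^ j * {F : IntermediateField ℚ L | Module.finrank ℚ F = 2 * 3 ^ (j + 1) ∧ ¬ IsTotallyReal F ∧ IsCyclic (F ≃ₐ[ℚ] F) ∧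
        ∀ σ : F ≃ₐ[ℚ] F, σ ^ (3 : ℕ) = AlgEquiv.refl → ∀ τ : F →+* ℂ,
          {φ : L →+* ℂ | φ.comp (algebraMap F L) = τ.comp σ.toRingEquiv.toRingHom ∧ φ ∈ Φ.1}.ncard =
            {φ : L →+* ℂ | φ.comp (algebraMap F L) = τ ∧ φ ∈ Φ.1}.ncard}.ncard +
        2 * ((3 - 1) * 3 ^ j) * {F : IntermediateField ℚ L | Module.finrank ℚ F = 4 * 3 ^ (j + 1) ∧ ¬ IsTotallyReal F ∧ IsCyclic (F ≃ₐ[ℚ] F) ∧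
        ∀ σ : F ≃ₐ[ℚ] F, σ ^ (3 : ℕ) = AlgEquiv.refl → ∀ τ : F →+* ℂ,
          {φ : L →+* ℂ | φ.comp (algebraMap F L) = τ.comp σ.toRingEquiv.toRingHom ∧ φ ∈ Φ.1}.ncard =
            {φ : L →+* ℂ | φ.comp (algebraMap F L) = τ ∧ φ ∈ Φ.1}.ncard}.ncard) = 55 := by
  haveI : Fact (Nat.Prime 3) := ⟨Nat.prime_three⟩
  have h := cmTypeRank_add_ncard_subfields_eq_of_isCyclotomicExtension (L := L) (q := 109) (k := 3) (by norm_num)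
    (by decide : (3 : ℕ) ≠ 2) ExponentFourTimesPrimePower.units_pow_oneHundredEight_oneHundredNine Φ
  have hφ : Nat.totient 109 = 108 := by decide
  rw [hφ] at h
  exact h

end Cyclotomic

end ExponentFourTimesPrimePowerRank

end Literature.AlgebraicGeometry.Pohlmann1968

end
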